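import Summits.MatrixMultiplication.MatrixMultiplication.Theses.GelfandPairHosts
import Summits.MatrixMultiplication.MatrixMultiplication.Theorems.GelfandPairHostsKillGlue

/-!
# `GelfandHosting` (crux stmt-MatrixMultiplication-7381, route GelfandPairHosts):
# counting constraints on module-TPP designs, and the trivial exponent-3 endpoint

Negative-side support file of the refuter's crux attack (2026-08-17); everything `sorry`-free,
no new definitions.  Notation: a finite group `G` acts on a finite set `X` (`N = |X|`), `P_g` is the
permutation matrix `(P_g) y x = [g • x = y]`, `D = dim span {P_g}` is the host cost, and a
module-TPP design of shape `(a,b,c)` is a triple `φ : [a]×[b] → G`, `ψ : [b]×[c] → X`,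
`χ : [a]×[c] → X` with `φ(i,j) • ψ(j',k) = χ(i',k') ↔ (i,j,k) = (i',j',k')`.

* §1 `cross_capacity` — the CROSS condition (`j ≠ j'` images avoid `im χ`) is a genuine constraint:
  one element `g = φ(i₀,j₀)` maps the `bc` points of `ψ` injectively and its image meets the `ac`
  points of `im χ` only inside `χ(i₀,·)`, so `bc + ac ≤ N + c`, i.e. `(a+b-1)·c ≤ N`
  (`cross_capacity'`).  Together with the tree's `ab ≤ D` (`killGlue_ab_le_finrank`, imported) this gives
* §2 `abc_le_or` — every design has `abc ≤ D` or `8·abc ≤ (N+2)²`; hence (`abc_le_of_sq_le`) a host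
  with `(N+2)² ≤ 8·D(G,X)` can NEVER "beat the squares" (crux `BeatTheSquares`, stmt-7383): this
  disposes of the route's named first instances `S_3² ↷ [3]²` (`N = 9`, `D = 25`: `121 ≤ 200`),
  `S_3³ ↷ [3]³` (`N = 27`, `D = 125`: `841 ≤ 1000`) and every dihedral `D_q ↷ q-gon` with `q ≤ 10`
  without any search, and shows that beating the squares needs `c ≥ 2`, `a,b ≥ 2` and
  `D < (N+2)²/8`, i.e. hosts of cost ratio `D/N ≲ N/8`.
* §3 `body_at_one` — the `∃`-body of `GelfandHosting` at `ε = 1` is TRUE (the regular `ℤ/2`-set,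
  `a = b = 1`, `c = 2`, `D = 2 = abc`): the exponent-`3` certificate is attained trivially, so the
  whole content of the crux is the range `ε < 1` (no degenerate witness reaches below `3`, since
  `c = 1 ⇒ abc = ab ≤ D` and `a = 1` or `b = 1 ⇒ abc ≤ N ≤ D`).

These lemmas do not decide the crux; they sharpen the necessary conditions recorded in
`GelfandPairHostsKillGlue.lean` (`bc ≤ N`, `ac ≤ N`, `ab ≤ D`, `N ≤ D`).
-/

-- the tree's namespace `Summit.MatrixMultiplication.MatrixMultiplication.…` repeats a component by design
set_option linter.dupNamespace false

namespace Summit.MatrixMultiplication.MatrixMultiplication.Theorems.GelfandHosting.Negative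

open scoped BigOperators
open Summit.MatrixMultiplication.MatrixMultiplication.Theorems (killGlue_ab_le_finrank)

/-! ## §1 Cross-capacity `(a+b-1)·c ≤ N` -/

section Design

variable {G X : Type*} [Group G] [MulAction G X] [Fintype X] {a b c : ℕ}
  (φ : Fin a × Fin b → G) (ψ : Fin b × Fin c → X) (χ : Fin a × Fin c → X)

/-- **Cross-capacity** of a module-TPP design: `bc + ac ≤ |X| + c`.  The element `g = φ(i₀,j₀)`
maps the `bc` (distinct) points `ψ(j,k)` to distinct points; such an image equals a point
`χ(i,k')` of `im χ` (which has `ac` distinct points) only if `i = i₀` (design condition), so the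
two sets overlap in at most the `c` points `χ(i₀,·)`. [folklore] -/
theorem cross_capacity (i₀ : Fin a) (j₀ : Fin b)
    (hdes : ∀ (i i' : Fin a) (j j' : Fin b) (k k' : Fin c),
      φ (i, j) • ψ (j', k) = χ (i', k') ↔ (i = i' ∧ j = j' ∧ k = k')) :
    b * c + a * c ≤ Fintype.card X + c := by
  classical
  set g : G := φ (i₀, j₀) with hg
  set S1 : Finset X := Finset.univ.image (fun jk : Fin b × Fin c => g • ψ jk) with hS1
  set S2 : Finset X := Finset.univ.image χ with hS2
  set S3 : Finset X := Finset.univ.image (fun k : Fin c => χ (i₀, k)) with hS3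
  have hψ : Function.Injective ψ := by
    rintro ⟨j, k⟩ ⟨j', k'⟩ hjk
    have h1 : φ (i₀, j) • ψ (j, k) = χ (i₀, k) := (hdes i₀ i₀ j j k k).mpr ⟨rfl, rfl, rfl⟩
    rw [hjk] at h1
    obtain ⟨-, hj, hk⟩ := (hdes i₀ i₀ j j' k' k).mp h1
    rw [hj, hk]
  have hχ : Function.Injective χ := by
    rintro ⟨i, k⟩ ⟨i', k'⟩ hik
    have h1 : φ (i, j₀) • ψ (j₀, k) = χ (i, k) := (hdes i i j₀ j₀ k k).mpr ⟨rfl, rfl, rfl⟩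
    rw [hik] at h1
    obtain ⟨hi, -, hk⟩ := (hdes i i' j₀ j₀ k k').mp h1
    rw [hi, hk]
  have hgψ : Function.Injective (fun jk : Fin b × Fin c => g • ψ jk) :=
    fun jk jk' h => hψ (smul_left_cancel g h)
  have c1 : S1.card = b * c := by
    rw [hS1, Finset.card_image_of_injective _ hgψ]
    simp [Fintype.card_prod, Fintype.card_fin]
  have c2 : S2.card = a * c := by
    rw [hS2, Finset.card_image_of_injective _ hχ]
    simp [Fintype.card_prod, Fintype.card_fin]
  have c3 : S3.card ≤ c := by
    calc S3.card ≤ (Finset.univ : Finset (Fin c)).card := Finset.card_image_le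
      _ = c := by simp
  have hinter : S1 ∩ S2 ⊆ S3 := by
    intro x hx
    rw [Finset.mem_inter] at hx
    obtain ⟨h1, h2⟩ := hx
    rw [hS1, Finset.mem_image] at h1
    rw [hS2, Finset.mem_image] at h2
    obtain ⟨⟨j, k⟩, -, rfl⟩ := h1
    obtain ⟨⟨i, k'⟩, -, hik⟩ := h2
    obtain ⟨hi, -, -⟩ := (hdes i₀ i j₀ j k k').mp hik.symm
    rw [hS3, Finset.mem_image]
    exact ⟨k', Finset.mem_univ _, by rw [← hik, hi]⟩
  have hu : (S1 ∪ S2).card ≤ Fintype.card X := Finset.card_le_univ _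
  have key := Finset.card_union_add_card_inter S1 S2
  have hi' : (S1 ∩ S2).card ≤ c := (Finset.card_le_card hinter).trans c3
  omega

/-- Cross-capacity in the form `(a + b - 1)·c ≤ |X|`. [folklore] -/
theorem cross_capacity' (i₀ : Fin a) (j₀ : Fin b)
    (hdes : ∀ (i i' : Fin a) (j j' : Fin b) (k k' : Fin c),
      φ (i, j) • ψ (j', k) = χ (i', k') ↔ (i = i' ∧ j = j' ∧ k = k')) :
    (a + b - 1) * c ≤ Fintype.card X := by
  have h := cross_capacity φ ψ χ i₀ j₀ hdes
  have ha : 1 ≤ a := Nat.succ_le_of_lt i₀.pos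
  obtain ⟨a', rfl⟩ : ∃ a', a = a' + 1 := ⟨a - 1, by omega⟩
  have e : (a' + 1 + b - 1) * c + c = b * c + (a' + 1) * c := by
    rw [show a' + 1 + b - 1 = a' + b from by omega]
    ring
  omega

/-- `c ≤ |X|` for a design with `b ≥ 1` (from the injectivity of `ψ`). [folklore] -/
theorem c_le_card (i₀ : Fin a) (j₀ : Fin b)
    (hdes : ∀ (i i' : Fin a) (j j' : Fin b) (k k' : Fin c),
      φ (i, j) • ψ (j', k) = χ (i', k') ↔ (i = i' ∧ j = j' ∧ k = k')) :
    c ≤ Fintype.card X := by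
  have h := cross_capacity φ ψ χ i₀ j₀ hdes
  have hb : 1 ≤ b := Nat.succ_le_of_lt j₀.pos
  have ha : 1 ≤ a := Nat.succ_le_of_lt i₀.pos
  nlinarith

end Design

/-! ## §2 No design beats the squares in a host with `(N+2)² ≤ 8D` -/

/-- The arithmetic: `2 ≤ c ≤ N` and `bc + ac ≤ N + c` force `8abc ≤ (N+2)²`
(`4ab ≤ (a+b)²`, `(a+b)c ≤ N+c`, and `2(N+c)² ≤ c(N+2)²` because `(c-2)(N²-2c) ≥ 0`). [folklore] -/
theorem eight_mul_le_sq_arith (a b c N : ℕ) (hc : 2 ≤ c) (hcN : c ≤ N)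
    (h : b * c + a * c ≤ N + c) : 8 * (a * b * c) ≤ (N + 2) ^ 2 := by
  have hcpos : 0 < c := by omega
  suffices hs : 8 * (a * b * c) * c ≤ (N + 2) ^ 2 * c from Nat.le_of_mul_le_mul_right hs hcpos
  have h1 : 4 * (a * b) ≤ (a + b) ^ 2 := by
    zify
    nlinarith [sq_nonneg ((a : ℤ) - b)]
  have h2 : (a + b) * c ≤ N + c := by nlinarith [h]
  have h3 : ((a + b) * c) ^ 2 ≤ (N + c) ^ 2 := Nat.pow_le_pow_left h2 2
  have hN2 : 2 * c ≤ N * N := by nlinarith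
  have h4 : 2 * (N + c) ^ 2 ≤ c * (N + 2) ^ 2 := by
    zify at hc hN2 ⊢
    nlinarith [mul_nonneg (sub_nonneg.2 hc) (sub_nonneg.2 hN2)]
  calc 8 * (a * b * c) * c = 2 * (4 * (a * b)) * c ^ 2 := by ring
    _ ≤ 2 * (a + b) ^ 2 * c ^ 2 := by gcongr
    _ = 2 * ((a + b) * c) ^ 2 := by ring
    _ ≤ 2 * (N + c) ^ 2 := by linarith [h3]
    _ ≤ c * (N + 2) ^ 2 := h4
    _ = (N + 2) ^ 2 * c := by ring

section Beat

variable {G X : Type*} [Group G] [MulAction G X] [Fintype X] [DecidableEq X] {a b c : ℕ}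
  (φ : Fin a × Fin b → G) (ψ : Fin b × Fin c → X) (χ : Fin a × Fin c → X)

/-- **Dichotomy.** Every module-TPP design (with `a, b, c ≥ 1`) has `abc ≤ D` (when `c = 1`) or
`8·abc ≤ (|X|+2)²` (when `c ≥ 2`).  No multiplicity-freeness is needed. [folklore] -/
theorem abc_le_or (i₀ : Fin a) (j₀ : Fin b) (k₀ : Fin c)
    (hdes : ∀ (i i' : Fin a) (j j' : Fin b) (k k' : Fin c),
      φ (i, j) • ψ (j', k) = χ (i', k') ↔ (i = i' ∧ j = j' ∧ k = k')) :
    a * b * c ≤ Module.finrank ℂ (Submodule.span ℂ (Set.range fun g : G =>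
      Matrix.of fun y x : X => if g • x = y then (1 : ℂ) else 0)) ∨
    8 * (a * b * c) ≤ (Fintype.card X + 2) ^ 2 := by
  rcases Nat.lt_or_ge c 2 with hc | hc
  · left
    have hc1 : c = 1 := by have := k₀.pos; omega
    subst hc1
    simpa using killGlue_ab_le_finrank φ ψ χ k₀ hdes
  · right
    exact eight_mul_le_sq_arith a b c _ hc (c_le_card φ ψ χ i₀ j₀ hdes)
      (cross_capacity φ ψ χ i₀ j₀ hdes)

/-- **No beating the squares in small-ratio hosts.** If `(|X|+2)² ≤ 8·D(G,X)` then every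
module-TPP design in the `G`-set `X` has `abc ≤ D(G,X)` — e.g. `S_3² ↷ [3]²` (`N = 9`, `D = 25`),
`S_3³ ↷ [3]³` (`N = 27`, `D = 125`), `D_q ↷ q`-gon for `q ≤ 10`. [folklore] -/
theorem abc_le_of_sq_le
    (hdes : ∀ (i i' : Fin a) (j j' : Fin b) (k k' : Fin c),
      φ (i, j) • ψ (j', k) = χ (i', k') ↔ (i = i' ∧ j = j' ∧ k = k'))
    (hhost : (Fintype.card X + 2) ^ 2 ≤ 8 * Module.finrank ℂ (Submodule.span ℂ (Set.range
      fun g : G => Matrix.of fun y x : X => if g • x = y then (1 : ℂ) else 0))) :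
    a * b * c ≤ Module.finrank ℂ (Submodule.span ℂ (Set.range fun g : G =>
      Matrix.of fun y x : X => if g • x = y then (1 : ℂ) else 0)) := by
  rcases Nat.eq_zero_or_pos a with ha | ha
  · subst ha; simp
  rcases Nat.eq_zero_or_pos b with hb | hb
  · subst hb; simp
  rcases Nat.eq_zero_or_pos c with hc | hc
  · subst hc; simp
  rcases abc_le_or φ ψ χ ⟨0, ha⟩ ⟨0, hb⟩ ⟨0, hc⟩ hdes with h | h
  · exact h
  · -- 8abc ≤ (N+2)² ≤ 8D
    have := h.trans hhost
    omega

end Beat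

/-! ## §3 The exponent-3 endpoint: the `∃`-body of `GelfandHosting` holds at `ε = 1` -/

/-- **Trivial endpoint.** The body of `GelfandHosting` is satisfiable at `ε = 1`
(`D ≤ (abc)^{(2+1)/3} = abc`): the regular `ℤ/2`-set (`G = Perm (Fin 2) ↷ Fin 2`), `a = b = 1`,
`c = 2`, `φ ≡ 1`, `ψ = χ =` the enumeration; `D = 2 = abc`.  So the hypotheses of the crux are
jointly satisfiable and its content is exactly the range `ε < 1`. [folklore] -/
theorem body_at_one : ∃ (G : Type) (_ : Group G) (_ : Fintype G) (X : Type) (_ : Fintype X)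
    (_ : DecidableEq X) (_ : MulAction G X) (a b c : ℕ) (φ : Fin a × Fin b → G)
    (ψ : Fin b × Fin c → X) (χ : Fin a × Fin c → X),
    (∀ A B : Matrix X X ℂ, (∀ (g : G) (x y : X), A (g • x) (g • y) = A x y) →
      (∀ (g : G) (x y : X), B (g • x) (g • y) = B x y) → A * B = B * A) ∧ 2 ≤ a * b * c ∧
    (∀ (i i' : Fin a) (j j' : Fin b) (k k' : Fin c),
      φ (i, j) • ψ (j', k) = χ (i', k') ↔ (i = i' ∧ j = j' ∧ k = k')) ∧
    (Module.finrank ℂ (Submodule.span ℂ (Set.range fun g : G => Matrix.of fun y x : X =>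
      if g • x = y then (1 : ℂ) else 0)) : ℝ) ≤ ((a * b * c : ℕ) : ℝ) ^ ((2 + (1 : ℝ)) / 3) := by
  refine ⟨Equiv.Perm (Fin 2), inferInstance, inferInstance, Fin 2, inferInstance, inferInstance,
    inferInstance, 1, 1, 2, fun _ => 1, fun jk => jk.2, fun ik => ik.2, ?_, by norm_num, ?_, ?_⟩
  · -- multiplicity-free: swap-invariant 2×2 matrices are `[[p,q],[q,p]]` and commute
    intro A B hA hB
    have hA1 := hA (Equiv.swap 0 1) 0 0
    have hA2 := hA (Equiv.swap 0 1) 0 1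
    have hB1 := hB (Equiv.swap 0 1) 0 0
    have hB2 := hB (Equiv.swap 0 1) 0 1
    simp only [Equiv.Perm.smul_def, Equiv.swap_apply_left, Equiv.swap_apply_right] at hA1 hA2 hB1 hB2
    ext i j
    fin_cases i <;> fin_cases j <;>
      simp only [Matrix.mul_apply, Fin.sum_univ_two, Fin.zero_eta, Fin.mk_one, Fin.isValue] <;>
      simp only [hA1, hA2, hB1, hB2] <;> ring
  · -- design condition
    intro i i' j j' k k'
    simp only [one_smul]
    exact ⟨fun h => ⟨Subsingleton.elim _ _, Subsingleton.elim _ _, h⟩, fun ⟨_, _, h⟩ => h⟩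
  · -- `D ≤ |G| = 2 = (abc)^1`
    have hD : Module.finrank ℂ (Submodule.span ℂ (Set.range fun g : Equiv.Perm (Fin 2) =>
        Matrix.of fun y x : Fin 2 => if g • x = y then (1 : ℂ) else 0)) ≤ 2 := by
      have := finrank_range_le_card (R := ℂ) (fun g : Equiv.Perm (Fin 2) =>
        Matrix.of fun y x : Fin 2 => if g • x = y then (1 : ℂ) else 0)
      simpa [Set.finrank, Fintype.card_perm] using this
    norm_num
    exact_mod_cast hD

end Summit.MatrixMultiplication.MatrixMultiplication.Theorems.GelfandHosting.Negative
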